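import Summits.CriticalPhenomena.CardyFormulaZ2.Theorems.CardySusyWardParafermionFamiliesToSLESixHalfCRVertexRelation
import Summits.CriticalPhenomena.CardyFormulaZ2.Theorems.CardyComplexConeEdgePrecompactShiftStabilityReduction
import Literature.Barriers.CriticalPhenomena.FKParafermionicHalfCauchyRiemann
import Literature.Probability.LatticeModels.DartPhase
import HarnessLib

/-!
# Stub `stub_halfCR` of crux `CardySelfRefinement.SymmetryUpgradeR` (stmt-CriticalPhenomena-17239),
# line `zhou-rotation-split-audit` (S1)

The `q = 1`, `σ = 1/3` half Cauchy–Riemann VERTEX RELATION of Smirnov's edge parafermionic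
observable `F(e) = E_{1/2}[exp(−(i/3) W(e)) 1_{e ∈ γ}]` of the medial exploration path of a finite
`ℤ²`-admissible discrete Dobrushin datum `E` with hole-free inner faces, read as the tree's
`bondDartObservable E E.δ (1/3)`: at every interior medial vertex `p ∈ halfCREquations E`,
`F(NW) − F(SE) = c (F(NE) − F(SW))` with `c = i` (Duminil-Copin 2012, Prop. 4 / DCS 2012, Prop. 8.6
at `q = 1`; Zhou arXiv:2409.03235, eq. (2)).  It fixes the convention `c` for the other stubs of the
line.

Proof.  `c := i`.  For `p ∈ halfCREquations E` the lattice edge `medialVertexOf p` is an edge of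
`Ω_δ` with no endpoint on the arcs, hence (admissibility: the arcs cover `zdBoundary`) no endpoint on
the square-lattice discrete boundary; by `DiscreteDobrushin.faces_dichotomy` at the endpoint `p.1`
either all four faces around `p.1` are inner or none is.
* All inner: both faces of the edge are faces around `p.1`, so the tree theorem
  `S2.halfCRVertexRelation_of_holeFree` (Theorems/CardySusyWardParafermionFamiliesToSLESixHalfCRVertexRelation.lean)
  applies at reading mesh `δ := E.δ`, and `cornerObs E δ v f = bondDartObservable E δ (1/3) (v, f)`
  (`cornerObs_eq_bondDartObservable`).
* None inner: the faces of the four corners `medialCornersAt p.1 p.2 k` are faces around `p.1`,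
  hence non-inner, and the dart observable of a corner with a non-inner face vanishes identically
  (the exploration path only steps through inner faces, `IsMedialExploration.step`, and a medial
  dart determines its corner, `IsCorner.eq_of_cornerSource_eq_of_cornerTarget_eq_holds`); the
  relation reads `0 − 0 = i (0 − 0)`.
-/

noncomputable section

namespace Summit.CriticalPhenomena.CardyFormulaZ2.Theorems.SymmetryUpgradeR.ZhouRotationSplitAudit

open MeasureTheory
open Literature.Probability.LatticeModels
open Literature.Probability.Percolation (BondConfig bondPercolation half)
open Literature.Barriers.CriticalPhenomena (medialCornersAt medialVertexOf HalfCRRelationAt halfCREquations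
  mem_halfCREquations_iff isCorner_medialCornersAt)
open Summit.CriticalPhenomena.CardyFormulaZ2.Cruxes.EdgePrecompact.QkzStripBoundaryArm (cornerObs
  cornerObs_eq_bondDartObservable)
open Summit.CriticalPhenomena.CardyFormulaZ2.Theorems.ParafermionFamiliesToSLESix.StripAnchored
  (S2.halfCRVertexRelation_of_holeFree)

/-! ## The dart observable vanishes at corners with a non-inner face -/

/-- Pathwise: the exploration path of an admissible datum never traverses the dart of a corner
whose face is not inner (it steps through inner faces only, and a medial dart determines its
corner), so the phase sum of such a dart vanishes. -/
theorem dartPhaseSum_medialExploration_eq_zero_of_not_isInnerFace {E : DiscreteDobrushin}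
    (hE : E.IsZdAdmissible) (ω : BondConfig (Site 2)) (δ σ : ℝ) {c : Site 2 × Site 2}
    (hc : IsCorner c.1 c.2) (hf : ¬ E.IsInnerFace c.2) :
    dartPhaseSum (medialExploration E ω) δ σ c = 0 := by
  unfold dartPhaseSum
  refine Finset.sum_eq_zero fun k hk => ?_
  exfalso
  obtain ⟨-, h1, h2⟩ := Finset.mem_filter.1 hk
  obtain ⟨hk0, e0⟩ := List.getElem?_eq_some_iff.1 h1
  obtain ⟨hk1, e1⟩ := List.getElem?_eq_some_iff.1 h2
  have hinf : [cornerSource c.1 c.2, cornerTarget c.1 c.2] <:+: medialExploration E ω := by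
    rw [← e0, ← e1]
    exact infix_pair_getElem _ k hk1
  obtain ⟨v, f, hv, hf', hs, ht⟩ := (isMedialExploration_medialExploration_holds E hE ω).step _ _ hinf
  obtain ⟨-, rfl⟩ := IsCorner.eq_of_cornerSource_eq_of_cornerTarget_eq_holds hv hc hs ht
  exact hf hf'

/-- The dart observable `bondDartObservable E δ σ (v, f)` of an admissible datum vanishes at every
corner `(v, f)` whose face `f` is not an inner face of the datum. -/
theorem bondDartObservable_eq_zero_of_not_isInnerFace {E : DiscreteDobrushin} (hE : E.IsZdAdmissible)
    (δ σ : ℝ) {c : Site 2 × Site 2} (hc : IsCorner c.1 c.2) (hf : ¬ E.IsInnerFace c.2) :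
    bondDartObservable E δ σ c = 0 := by
  rw [bondDartObservable_def]
  simp only [dartPhaseSum_medialExploration_eq_zero_of_not_isInnerFace hE _ δ σ hc hf, integral_zero]

/-! ## The faces at a medial vertex -/

/-- The face of each of the four corners at the medial vertex `s(x, x + eᵢ)` has `x` as a corner
(it is one of the two faces of the lattice edge, both of which are faces around `x`). -/
theorem isCorner_fst_medialCornersAt (x : Site 2) (i : Fin 2) (k : Fin 4) :
    IsCorner x (medialCornersAt x i k).2 := by
  fin_cases i <;> fin_cases k <;> intro j <;> fin_cases j <;> simp [medialCornersAt]

/-- For `p ∈ halfCREquations E` with `E` admissible, the endpoint `p.1` of the medial vertex is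
off the square-lattice discrete boundary. -/
theorem fst_not_mem_zdBoundary {E : DiscreteDobrushin} (hE : E.IsZdAdmissible) {p : Site 2 × Fin 2}
    (hp : p ∈ halfCREquations E) : p.1 ∉ E.zdBoundary := by
  intro h
  have harc := ((E.mem_innerMedialVertices_iff).1 ((mem_halfCREquations_iff E).1 hp)).2 p.1
    (Sym2.mem_mk_left _ _)
  rcases hE.zdBoundary_subset h with h' | h'
  · exact harc.1 h'
  · exact harc.2 h'

/-! ## The vertex relation -/

/-- **The half-CR vertex relation for the dart observable, `c = i`**: for admissible `E` with
hole-free inner faces and positive mesh, at every `p ∈ halfCREquations E` the function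
`e ↦ bondDartObservable E E.δ (1/3) e` satisfies `HalfCRRelationAt i`. -/
theorem halfCRRelationAt_bondDartObservable (E : DiscreteDobrushin) (hE : E.IsZdAdmissible)
    (hH : HoleFree {f : Site 2 | E.IsInnerFace f}) (hδ : 0 < E.δ) (p : Site 2 × Fin 2)
    (hp : p ∈ halfCREquations E) :
    HalfCRRelationAt Complex.I (fun e : Site 2 × Site 2 => bondDartObservable E E.δ (1 / 3) e) p := by
  obtain ⟨he, harc⟩ := (E.mem_innerMedialVertices_iff).1 ((mem_halfCREquations_iff E).1 hp)
  rcases E.faces_dichotomy (fst_not_mem_zdBoundary hE hp) with hall | hnone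
  · -- both faces of the edge are inner: the tree theorem at reading mesh `E.δ`
    have hf : ∀ f : Site 2, IsCorner p.1 f → IsCorner (p.1 + Pi.single p.2 1) f → E.IsInnerFace f := by
      intro f h1 _
      obtain ⟨j, rfl⟩ := exists_faceAt_of_isCorner h1
      exact hall j
    have h := S2.halfCRVertexRelation_of_holeFree E hE hH p he harc hf E.δ hδ
    have hfun : (fun c : Site 2 × Site 2 => cornerObs E E.δ c.1 c.2) =
        fun e : Site 2 × Site 2 => bondDartObservable E E.δ (1 / 3) e := by
      funext e
      exact cornerObs_eq_bondDartObservable E E.δ e.1 e.2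
    rw [hfun] at h
    exact h
  · -- no face at `p.1` is inner: all four corner values vanish
    have hz : ∀ k : Fin 4, bondDartObservable E E.δ (1 / 3) (medialCornersAt p.1 p.2 k) = 0 := by
      intro k
      refine bondDartObservable_eq_zero_of_not_isInnerFace hE _ _ (isCorner_medialCornersAt p.1 p.2 k) ?_
      obtain ⟨j, hj⟩ := exists_faceAt_of_isCorner (isCorner_fst_medialCornersAt p.1 p.2 k)
      rw [hj]
      exact hnone j
    simp only [HalfCRRelationAt, hz, sub_self, mul_zero]

/-- Registered stub `stub_halfCR` (S1) of the line `zhou-rotation-split-audit` of crux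
`CardySelfRefinement.SymmetryUpgradeR` (stmt-CriticalPhenomena-17239): Duminil-Copin 2012 Prop. 4 /
DCS 2012 Prop. 8.6 at `q = 1` / Zhou (2) for the tree's medial exploration and the edge observable
`bondDartObservable E E.δ (1/3)`: for some `c ∈ {i, −i}` (namely `c = i`) the vertex relation holds at
every interior medial vertex of every finite admissible datum with hole-free inner faces.  The
signature is `∃ c ∈ {i, −i}, HalfCR c` with `HalfCR` unfolded to tree vocabulary. -/
theorem stub_halfCR : ∃ c : ℂ, (c = Complex.I ∨ c = -Complex.I) ∧
    ∀ E : DiscreteDobrushin, E.IsZdAdmissible → HoleFree {f : Site 2 | E.IsInnerFace f} → 0 < E.δ →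
      (meshDomain E.Ω E.δ).Finite → ∀ p ∈ halfCREquations E,
        HalfCRRelationAt c (fun e : Site 2 × Site 2 => bondDartObservable E E.δ (1 / 3) e) p :=
  ⟨Complex.I, Or.inl rfl, fun E hE hH hδ _ p hp => halfCRRelationAt_bondDartObservable E hE hH hδ p hp⟩

end Summit.CriticalPhenomena.CardyFormulaZ2.Theorems.SymmetryUpgradeR.ZhouRotationSplitAudit

end
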